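import Literature.AlgebraicGeometry.Resolution.MonoidalEFReduction
import Literature.AlgebraicGeometry.Resolution.MonoidalTransformFrameStepTracked
import HarnessLib

/-!
# [CoP1] Prop. 8.1: the reduction `E = F`, WITH the bookkeeping of property (1)

Topic: `Literature/AlgebraicGeometry/Resolution`. PROOF side of `CossartPiltant2019ReductionP`
(`ArithmeticalThreefoldsLocal.lean`), input (C4): the head of the decomposition layer of
[CoP1] Prop. 9.3 is [CoP1] Prop. 8.1 in the model reading `exists_localUniformization_of_head'`
(`DecompositionLayerStrictParameters.lean`), whose clause (c′) = property (1) of Prop. 8.1,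
"`(S₀)_f = S_f`", asks that the final local uniformization be the local ring of a model
`S[t′]` with `fⁿ t′ ⊆ R₀` (`R₀ = R₁′`). `MonoidalEFReduction.lean` proves the reduction `E = F`
of the printed proof (HAL hal-00139124, p. 23: "after possibly replacing `S₂` by an iterated
monoidal transform along `W`, it can be assumed that `E = F`. Note that property (1) of the
proposition is preserved by this construction") WITHOUT this bookkeeping; this file is the
TRACKED copy, each step being `exists_frameStepTracked_of_valuation_lt_one` / `…_eq_one`
(`MonoidalTransformFrameStepTracked.lean`): the chart denominators `x_{i₁}` (`i₁ ∈ E`) and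
`x_{i₂}` (`i₂ ∈ F ⊆ E`) divide `f = u ∏ x^α`, so `f · z` lies in the current local ring.

* `exists_frameStepTracked_measure_lt`, `exists_frameStepsTracked_measure_lt`,
  `exists_frameStepsTracked_supp_eq`, `exists_frameStepsTracked_supp_eq_of_rankOne` — the
  tracked forms of the corresponding theorems of `MonoidalEFReduction.lean`.

Everything is PROVED; no named facts, definitions, instances or notation are introduced.

## Sources

* V. Cossart, O. Piltant, J. Algebra 320 (2008) 1051–1082: Prop. 8.1 (1) and its proof (HAL
  hal-00139124, pp. 22–23). [CossartPiltant2008]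
-/

noncomputable section

namespace Literature.AlgebraicGeometry.Resolution

universe u

open IsLocalRing _root_.Polynomial Function

section EFReductionTracked

variable {S : Type u} [CommRing S] [IsDomain S] [IsLocalRing S] {E : Type u} [Field E]
  [Algebra S E] [Algebra.IsAlgebraic S E]
  (hSuc : IsUniversallyCatenaryRing S) (hinj : Function.Injective (algebraMap S E))
  (O : ValuationSubring E) (hSO : ∀ s : S, algebraMap S E s ∈ O)
  (hdom : ∀ s ∈ maximalIdeal S, O.valuation (algebraMap S E s) < 1)
  (hres : ∀ y : O, ∃ q : S[X], (∃ i, q.coeff i ∉ maximalIdeal S) ∧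
    O.valuation (q.eval₂ (algebraMap S E) y) < 1)
  {d : ℕ} (hSdim : ringKrullDim S = d)
  (R₀ : Subring E) (hSR₀ : ∀ s : S, algebraMap S E s ∈ R₀)

omit [IsDomain S] [IsLocalRing S] [Algebra.IsAlgebraic S E] in
/-- If `x_a` divides the monomial `f = u ∏ x^α` (`α_a > 0`, `u` in the local ring), then
`(x_b / x_a) · f` lies in the local ring (the chart denominator divides `f`, [CoP1] Prop. 8.1
(1)). [cite: CossartPiltant2008, Prop. 8.1 (1) (HAL p. 22)] -/
theorem div_mul_monomial_mem_locAtCentre (t : Set E)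
    (x : Fin d → locAtCentre (Algebra.adjoin S t).toSubring O) (f u : E)
    (huR : u ∈ locAtCentre (Algebra.adjoin S t).toSubring O) (α : Fin d → ℕ)
    (hf : f = u * ∏ c, (x c : E) ^ α c) (a b : Fin d) (hαa : 0 < α a) (hxa : (x a : E) ≠ 0) :
    (x b : E) / (x a : E) * f ∈ locAtCentre (Algebra.adjoin S t).toSubring O := by
  classical
  have hsplit : (∏ c, (x c : E) ^ α c) =
      (x a : E) ^ α a * ∏ c ∈ Finset.univ.erase a, (x c : E) ^ α c :=
    (Finset.mul_prod_erase _ _ (Finset.mem_univ a)).symm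
  have hαa' : α a = (α a - 1) + 1 := (Nat.sub_add_cancel hαa).symm
  have heq : (x b : E) / (x a : E) * f =
      u * (x b : E) * (x a : E) ^ (α a - 1) * ∏ c ∈ Finset.univ.erase a, (x c : E) ^ α c := by
    rw [hf, hsplit]
    conv_lhs => rw [hαa', pow_succ]
    field_simp
  rw [heq]
  exact Subring.mul_mem _ (Subring.mul_mem _ (Subring.mul_mem _ huR (x b).2)
    (Subring.pow_mem _ (x a).2 _)) (Subring.prod_mem _ fun c _ => Subring.pow_mem _ (x c).2 _)

include hSuc hinj hSO hdom hres hSdim in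
/-- In the frame, the members of a regular system of parameters of `R_t` are nonzero
(`dim R_t = d` by `ringKrullDim_locAtCentre_eq_of_frame`, and a minimal system of `d`
generators of `𝔪` has no zero member: minimality of a regular system of parameters).
[cite: Matsumura1987, Thm. 14.2] -/
theorem coe_rsop_ne_zero_of_frame (t : Set E) (ht : t.Finite)
    (hTO : (Algebra.adjoin S t).toSubring ≤ O.toSubring)
    (hreg : IsRegularLocalRing (locAtCentre (Algebra.adjoin S t).toSubring O))
    (x : Fin d → locAtCentre (Algebra.adjoin S t).toSubring O)
    (hx : haveI := isLocalRing_locAtCentre hTO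
      Ideal.span (Set.range x) = maximalIdeal _)
    (k : Fin d) : (x k : E) ≠ 0 := by
  haveI := isLocalRing_locAtCentre hTO
  haveI := hreg
  intro hz
  have hdimR : ringKrullDim (locAtCentre (Algebra.adjoin S t).toSubring O) = d := by
    haveI : Algebra.FiniteType S (Algebra.adjoin S t) := by
      rw [← ht.coe_toFinset]
      exact (Subalgebra.fg_iff_finiteType _).mp (Subalgebra.fg_adjoin_finset _)
    rw [ringKrullDim_locAtCentre_eq_of_frame hSuc hinj O hSO hdom hres (Algebra.adjoin S t) hTO,
      hSdim]
  have hd : (maximalIdeal (locAtCentre (Algebra.adjoin S t).toSubring O)).spanFinrank = d := by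
    have h := IsRegularLocalRing.spanFinrank_maximalIdeal
      (R := locAtCentre (Algebra.adjoin S t).toSubring O)
    rw [hdimR] at h
    exact_mod_cast h
  have hnot : k ∉ (∅ : Set (Fin d)) := Set.notMem_empty _
  have := not_mem_span_image_of_not_mem hd x hx hnot
  rw [Set.image_empty, Ideal.span_empty] at this
  exact this (by rw [show x k = 0 from Subtype.ext hz]; exact Submodule.zero_mem ⊥)

set_option maxHeartbeats 1600000 in
include hSuc hinj hSO hdom hres hSdim hSR₀ in
/-- **One step of the `E = F` reduction lowers `♯(E ∖ F)`, tracked** ([CoP1] HAL p. 23, case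
`W y_{i₂} ≥ W y_{i₁}`, with property (1)): as `exists_frameStep_measure_lt`, for a model with
`fⁿ t ⊆ R₀` (`f ∈ R₀ ⊇ S`), the new model again satisfies `fⁿ t′ ⊆ R₀`.
[cite: CossartPiltant2008, proof of Prop. 8.1 (HAL p. 23)] -/
theorem exists_frameStepTracked_measure_lt (f : E) (hfR₀ : f ∈ R₀)
    (t : Set E) (ht : t.Finite) (hTR : ∀ y ∈ t, ∃ n : ℕ, f ^ n * y ∈ R₀)
    (hTO : (Algebra.adjoin S t).toSubring ≤ O.toSubring)
    (hreg : IsRegularLocalRing (locAtCentre (Algebra.adjoin S t).toSubring O))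
    (x : Fin d → locAtCentre (Algebra.adjoin S t).toSubring O)
    (hx : haveI := isLocalRing_locAtCentre hTO
      Ideal.span (Set.range x) = maximalIdeal _)
    (h u w : E) (huR : u ∈ locAtCentre (Algebra.adjoin S t).toSubring O)
    (hvu : O.valuation u = 1) (hwR : w ∈ locAtCentre (Algebra.adjoin S t).toSubring O)
    (hvw : O.valuation w = 1) (α β : Fin d → ℕ)
    (hf : f = u * ∏ c, (x c : E) ^ α c) (hh : h = w * ∏ c, (x c : E) ^ β c)
    (hFE : ∀ c, 0 < β c → 0 < α c) (i₁ i₂ : Fin d) (hα₁ : 0 < α i₁) (hβ₁ : β i₁ = 0)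
    (hβ₂ : 0 < β i₂) (hle : O.valuation (x i₂ : E) ≤ O.valuation (x i₁ : E)) :
    ∃ (t' : Set E), t ⊆ t' ∧ t'.Finite ∧ (∀ y ∈ t', ∃ n : ℕ, f ^ n * y ∈ R₀) ∧
      ∃ (hT'O : (Algebra.adjoin S t').toSubring ≤ O.toSubring),
        IsRegularLocalRing (locAtCentre (Algebra.adjoin S t').toSubring O) ∧
        ∃ (x' : Fin d → locAtCentre (Algebra.adjoin S t').toSubring O) (u' w' : E)
          (α' β' : Fin d → ℕ),
          (haveI := isLocalRing_locAtCentre hT'O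
           Ideal.span (Set.range x') = maximalIdeal _) ∧
          u' ∈ locAtCentre (Algebra.adjoin S t').toSubring O ∧ O.valuation u' = 1 ∧
          w' ∈ locAtCentre (Algebra.adjoin S t').toSubring O ∧ O.valuation w' = 1 ∧
          f = u' * ∏ c, (x' c : E) ^ α' c ∧ h = w' * ∏ c, (x' c : E) ^ β' c ∧
          (∀ c, 0 < β' c → 0 < α' c) ∧ (∃ c, 0 < β' c) ∧
          (Finset.univ.filter (fun c => 0 < α' c ∧ β' c = 0)).card <
            (Finset.univ.filter (fun c => 0 < α c ∧ β c = 0)).card := by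
  classical
  have h12 : i₁ ≠ i₂ := by rintro rfl; exact (Nat.lt_irrefl 0) (hβ₁ ▸ hβ₂)
  set z : E := (x i₂ : E) / (x i₁ : E) with hzdef
  haveI := isLocalRing_locAtCentre hTO
  -- the old measure set contains `i₁`
  have hi₁mem : i₁ ∈ Finset.univ.filter (fun c => 0 < α c ∧ β c = 0) :=
    Finset.mem_filter.mpr ⟨Finset.mem_univ _, hα₁, hβ₁⟩
  have hx10 : (x i₁ : E) ≠ 0 :=
    coe_rsop_ne_zero_of_frame hSuc hinj O hSO hdom hres hSdim t ht hTO hreg x hx i₁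
  have hzf : z * f ∈ locAtCentre (Algebra.adjoin S t).toSubring O :=
    div_mul_monomial_mem_locAtCentre O t x f u huR α hf i₁ i₂ hα₁ hx10
  have hzle : O.valuation z ≤ 1 := by
    rw [hzdef, map_div₀]; exact div_le_one_of_le₀ hle zero_le
  rcases hzle.lt_or_eq with hlt | h1
  · /- `v(z) > 0`: `z` is a new regular parameter, `i₁` enters `F` -/
    obtain ⟨t₁, htt₁, ht₁, hTR₁, hT₁O, hreg₁, x', hx'c, hx'b, hspan, hmono⟩ :=
      exists_frameStepTracked_of_valuation_lt_one hSuc hinj O hSO hdom hres hSdim R₀ hSR₀ f hfR₀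
        t ht hTR hTO hreg x hx i₁ i₂ h12 hlt hzf
    have hsub : locAtCentre (Algebra.adjoin S t).toSubring O ≤
        locAtCentre (Algebra.adjoin S t₁).toSubring O :=
      locAtCentre_mono O (fun y hy => Algebra.adjoin_mono htt₁ hy)
    refine ⟨t₁, htt₁, ht₁, hTR₁, hT₁O, hreg₁, x', u, w,
      Function.update α i₁ (α i₁ + α i₂), Function.update β i₁ (β i₁ + β i₂), hspan,
      hsub huR, hvu, hsub hwR, hvw, ?_, ?_, fun c hc => ?_, ⟨i₁, ?_⟩, ?_⟩
    · rw [hf, hmono α]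
    · rw [hh, hmono β]
    · by_cases hc1 : c = i₁
      · subst hc1
        rw [Function.update_self]
        exact Nat.add_pos_left hα₁ _
      · rw [Function.update_of_ne hc1] at hc ⊢
        exact hFE c hc
    · rw [Function.update_self, hβ₁, zero_add]; exact hβ₂
    · refine Finset.card_lt_card ⟨fun c hc => ?_, fun hsub' => ?_⟩
      · obtain ⟨-, hαc, hβc⟩ := Finset.mem_filter.mp hc
        have hc1 : c ≠ i₁ := by
          rintro rfl
          rw [Function.update_self, hβ₁, zero_add] at hβc
          exact absurd hβc (Nat.pos_iff_ne_zero.mp hβ₂)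
        rw [Function.update_of_ne hc1] at hαc hβc
        exact Finset.mem_filter.mpr ⟨Finset.mem_univ _, hαc, hβc⟩
      · have hb : Function.update β i₁ (β i₁ + β i₂) i₁ = 0 :=
          (Finset.mem_filter.mp (hsub' hi₁mem)).2.2
        rw [Function.update_self, hβ₁, zero_add] at hb
        exact absurd hb (Nat.pos_iff_ne_zero.mp hβ₂)
  · /- `v(z) = 0`: `z` is a unit, `i₂` leaves `E` and `F`, `i₁` enters `F` -/
    obtain ⟨t₁, htt₁, ht₁, hTR₁, hT₁O, hreg₁, hzR, x', hx'c, hspan, hmono⟩ :=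
      exists_frameStepTracked_of_valuation_eq_one hSuc hinj O hSO hdom hres hSdim R₀ hSR₀ f hfR₀
        t ht hTR hTO hreg x hx i₁ i₂ h12 h1 hzf
    have hsub : locAtCentre (Algebra.adjoin S t).toSubring O ≤
        locAtCentre (Algebra.adjoin S t₁).toSubring O :=
      locAtCentre_mono O (fun y hy => Algebra.adjoin_mono htt₁ hy)
    refine ⟨t₁, htt₁, ht₁, hTR₁, hT₁O, hreg₁, x',
      u * z ^ α i₂, w * z ^ β i₂,
      Function.update (Function.update α i₁ (α i₁ + α i₂)) i₂ 0,
      Function.update (Function.update β i₁ (β i₁ + β i₂)) i₂ 0, hspan,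
      Subring.mul_mem _ (hsub huR) (Subring.pow_mem _ hzR _), ?_,
      Subring.mul_mem _ (hsub hwR) (Subring.pow_mem _ hzR _), ?_, ?_, ?_,
      fun c hc => ?_, ⟨i₁, ?_⟩, ?_⟩
    · rw [map_mul, map_pow, hvu, h1, one_pow, one_mul]
    · rw [map_mul, map_pow, hvw, h1, one_pow, one_mul]
    · rw [hf, hmono α, mul_assoc]
    · rw [hh, hmono β, mul_assoc]
    · by_cases hc2 : c = i₂
      · subst hc2; rw [Function.update_self] at hc; exact absurd hc (Nat.lt_irrefl 0)
      · rw [Function.update_of_ne hc2] at hc ⊢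
        by_cases hc1 : c = i₁
        · subst hc1
          rw [Function.update_self]
          exact Nat.add_pos_left hα₁ _
        · rw [Function.update_of_ne hc1] at hc ⊢
          exact hFE c hc
    · rw [Function.update_of_ne h12, Function.update_self, hβ₁, zero_add]; exact hβ₂
    · refine Finset.card_lt_card ⟨fun c hc => ?_, fun hsub' => ?_⟩
      · obtain ⟨-, hαc, hβc⟩ := Finset.mem_filter.mp hc
        have hc2 : c ≠ i₂ := by
          rintro rfl
          rw [Function.update_self] at hαc
          exact (Nat.lt_irrefl 0) hαc
        rw [Function.update_of_ne hc2] at hαc hβc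
        have hc1 : c ≠ i₁ := by
          rintro rfl
          rw [Function.update_self, hβ₁, zero_add] at hβc
          exact absurd hβc (Nat.pos_iff_ne_zero.mp hβ₂)
        rw [Function.update_of_ne hc1] at hαc hβc
        exact Finset.mem_filter.mpr ⟨Finset.mem_univ _, hαc, hβc⟩
      · have hb : Function.update (Function.update β i₁ (β i₁ + β i₂)) i₂ 0 i₁ = 0 :=
          (Finset.mem_filter.mp (hsub' hi₁mem)).2.2
        rw [Function.update_of_ne h12, Function.update_self, hβ₁, zero_add] at hb
        exact absurd hb (Nat.pos_iff_ne_zero.mp hβ₂)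

set_option maxHeartbeats 1600000 in
include hSuc hinj hSO hdom hres hSdim hSR₀ in
/-- **"After iterating `n` times", tracked** ([CoP1] HAL p. 23): as
`exists_frameSteps_measure_lt`, keeping `fⁿ t ⊆ R₀`.
[cite: CossartPiltant2008, proof of Prop. 8.1 (HAL p. 23)] -/
theorem exists_frameStepsTracked_measure_lt (f : E) (hfR₀ : f ∈ R₀) (n : ℕ) :
    ∀ (t : Set E) (_ : t.Finite) (_ : ∀ y ∈ t, ∃ n : ℕ, f ^ n * y ∈ R₀)
      (hTO : (Algebra.adjoin S t).toSubring ≤ O.toSubring)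
      (_ : IsRegularLocalRing (locAtCentre (Algebra.adjoin S t).toSubring O))
      (x : Fin d → locAtCentre (Algebra.adjoin S t).toSubring O)
      (_ : haveI := isLocalRing_locAtCentre hTO
        Ideal.span (Set.range x) = maximalIdeal _)
      (h u w : E) (_ : u ∈ locAtCentre (Algebra.adjoin S t).toSubring O)
      (_ : O.valuation u = 1) (_ : w ∈ locAtCentre (Algebra.adjoin S t).toSubring O)
      (_ : O.valuation w = 1) (α β : Fin d → ℕ)
      (_ : f = u * ∏ c, (x c : E) ^ α c) (_ : h = w * ∏ c, (x c : E) ^ β c)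
      (_ : ∀ c, 0 < β c → 0 < α c) (i₁ i₂ : Fin d) (_ : 0 < α i₁) (_ : β i₁ = 0)
      (_ : 0 < β i₂) (_ : O.valuation (x i₂ : E) ^ n ≤ O.valuation (x i₁ : E)),
    ∃ (t' : Set E), t ⊆ t' ∧ t'.Finite ∧ (∀ y ∈ t', ∃ n : ℕ, f ^ n * y ∈ R₀) ∧
      ∃ (hT'O : (Algebra.adjoin S t').toSubring ≤ O.toSubring),
        IsRegularLocalRing (locAtCentre (Algebra.adjoin S t').toSubring O) ∧
        ∃ (x' : Fin d → locAtCentre (Algebra.adjoin S t').toSubring O) (u' w' : E)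
          (α' β' : Fin d → ℕ),
          (haveI := isLocalRing_locAtCentre hT'O
           Ideal.span (Set.range x') = maximalIdeal _) ∧
          u' ∈ locAtCentre (Algebra.adjoin S t').toSubring O ∧ O.valuation u' = 1 ∧
          w' ∈ locAtCentre (Algebra.adjoin S t').toSubring O ∧ O.valuation w' = 1 ∧
          f = u' * ∏ c, (x' c : E) ^ α' c ∧ h = w' * ∏ c, (x' c : E) ^ β' c ∧
          (∀ c, 0 < β' c → 0 < α' c) ∧ (∃ c, 0 < β' c) ∧
          (Finset.univ.filter (fun c => 0 < α' c ∧ β' c = 0)).card <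
            (Finset.univ.filter (fun c => 0 < α c ∧ β c = 0)).card := by
  classical
  induction n with
  | zero =>
    intro t ht hTR hTO hreg x hx h u w huR hvu hwR hvw α β hf hh hFE i₁ i₂ hα₁ hβ₁ hβ₂ hn
    exfalso
    haveI := isLocalRing_locAtCentre hTO
    have hlt : O.valuation (x i₁ : E) < 1 :=
      (mem_maximalIdeal_locAtCentre_iff hTO _).mp (hx ▸ Ideal.subset_span ⟨i₁, rfl⟩)
    rw [pow_zero] at hn
    exact (lt_irrefl _) (lt_of_le_of_lt hn hlt)
  | succ k ih =>
    intro t ht hTR hTO hreg x hx h u w huR hvu hwR hvw α β hf hh hFE i₁ i₂ hα₁ hβ₁ hβ₂ hn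
    by_cases hle : O.valuation (x i₂ : E) ≤ O.valuation (x i₁ : E)
    · exact exists_frameStepTracked_measure_lt hSuc hinj O hSO hdom hres hSdim R₀ hSR₀ f hfR₀ t
        ht hTR hTO hreg x hx h u w huR hvu hwR hvw α β hf hh hFE i₁ i₂ hα₁ hβ₁ hβ₂ hle
    · -- `W y_{i₂} < W y_{i₁}`: transform at `(x_{i₂}, x_{i₁})`, chart `z = x_{i₁}/x_{i₂}`
      have h12 : i₁ ≠ i₂ := by rintro rfl; exact (Nat.lt_irrefl 0) (hβ₁ ▸ hβ₂)
      have hlt' : O.valuation (x i₁ : E) < O.valuation (x i₂ : E) := lt_of_not_ge hle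
      haveI := isLocalRing_locAtCentre hTO
      have hx2ne : O.valuation (x i₂ : E) ≠ 0 := by
        intro h0
        rw [h0] at hlt'
        exact not_lt_of_ge zero_le hlt'
      have hzlt : O.valuation ((x i₁ : E) / (x i₂ : E)) < 1 := by
        rw [map_div₀, div_lt_one₀ (zero_lt_iff.mpr hx2ne)]
        exact hlt'
      have hzf : (x i₁ : E) / (x i₂ : E) * f ∈ locAtCentre (Algebra.adjoin S t).toSubring O :=
        div_mul_monomial_mem_locAtCentre O t x f u huR α hf i₂ i₁ (hFE _ hβ₂)
          (fun h0 => hx2ne (by rw [h0, map_zero]))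
      set z : E := (x i₁ : E) / (x i₂ : E) with hzdef
      obtain ⟨t₁, htt₁, ht₁, hTR₁, hT₁O, hreg₁, x', hx'c, hx'b, hspan, hmono⟩ :=
        exists_frameStepTracked_of_valuation_lt_one hSuc hinj O hSO hdom hres hSdim R₀ hSR₀ f hfR₀
          t ht hTR hTO hreg x hx i₂ i₁ h12.symm hzlt hzf
      have hsub : locAtCentre (Algebra.adjoin S t).toSubring O ≤
          locAtCentre (Algebra.adjoin S t₁).toSubring O :=
        locAtCentre_mono O (fun y hy => Algebra.adjoin_mono htt₁ hy)
      -- the new state has the same `E`, `F`, and a smaller archimedean bound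
      have hn' : O.valuation (x' i₂ : E) ^ k ≤ O.valuation (x' i₁ : E) := by
        rw [hx'c i₂ h12.symm, hx'b, map_div₀, le_div_iff₀ (zero_lt_iff.mpr hx2ne), ← pow_succ]
        exact hn
      obtain ⟨t', htt', ht', hTR', hT'O, hreg', x'', u', w', α', β', hspan', hu'R, hvu', hw'R,
        hvw', hf', hh', hFE', hF', hcard⟩ :=
        ih t₁ ht₁ hTR₁ hT₁O hreg₁ x' hspan h u w (hsub huR) hvu (hsub hwR) hvw
          (Function.update α i₂ (α i₂ + α i₁)) (Function.update β i₂ (β i₂ + β i₁))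
          (by rw [hf, hmono α]) (by rw [hh, hmono β])
          (fun c hc => by
            by_cases hc2 : c = i₂
            · subst hc2; rw [Function.update_self]; exact Nat.add_pos_left (hFE _ hβ₂) _
            · rw [Function.update_of_ne hc2] at hc ⊢; exact hFE c hc)
          i₁ i₂ (by rw [Function.update_of_ne h12]; exact hα₁)
          (by rw [Function.update_of_ne h12]; exact hβ₁)
          (by rw [Function.update_self]; exact Nat.add_pos_left hβ₂ _) hn'
      refine ⟨t', htt₁.trans htt', ht', hTR', hT'O, hreg', x'', u', w', α', β',
        hspan', hu'R, hvu', hw'R, hvw', hf', hh', hFE', hF', lt_of_lt_of_le hcard (le_of_eq ?_)⟩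
      -- the measure set is unchanged by this step
      congr 1
      ext c
      simp only [Finset.mem_filter, Finset.mem_univ, true_and]
      by_cases hc2 : c = i₂
      · subst hc2
        rw [Function.update_self, Function.update_self]
        constructor
        · rintro ⟨-, h0⟩; exact absurd h0 (Nat.ne_of_gt (Nat.add_pos_left hβ₂ _))
        · rintro ⟨-, h0⟩; exact absurd h0 (Nat.ne_of_gt hβ₂)
      · rw [Function.update_of_ne hc2, Function.update_of_ne hc2]

set_option maxHeartbeats 1600000 in
include hSuc hinj hSO hdom hres hSdim hSR₀ in
/-- **[CoP1] Prop. 8.1, the reduction to `E = F`, tracked** (HAL p. 23: "it can be assumed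
that `E = F`. Note that property (1) of the proposition is preserved by this construction"):
as `exists_frameSteps_supp_eq`, keeping `fⁿ t ⊆ R₀`, and recording `R_t ⊆ R_{t′}`.
[cite: CossartPiltant2008, proof of Prop. 8.1 (HAL p. 23)] -/
theorem exists_frameStepsTracked_supp_eq (f : E) (hfR₀ : f ∈ R₀)
    (harch : ∀ y z : E, z ≠ 0 → O.valuation y < 1 → ∃ n : ℕ, O.valuation y ^ n ≤ O.valuation z)
    (m : ℕ) :
    ∀ (t : Set E) (_ : t.Finite) (_ : ∀ y ∈ t, ∃ n : ℕ, f ^ n * y ∈ R₀)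
      (hTO : (Algebra.adjoin S t).toSubring ≤ O.toSubring)
      (_ : IsRegularLocalRing (locAtCentre (Algebra.adjoin S t).toSubring O))
      (x : Fin d → locAtCentre (Algebra.adjoin S t).toSubring O)
      (_ : haveI := isLocalRing_locAtCentre hTO
        Ideal.span (Set.range x) = maximalIdeal _)
      (h u w : E) (_ : u ∈ locAtCentre (Algebra.adjoin S t).toSubring O)
      (_ : O.valuation u = 1) (_ : w ∈ locAtCentre (Algebra.adjoin S t).toSubring O)
      (_ : O.valuation w = 1) (α β : Fin d → ℕ)
      (_ : f = u * ∏ c, (x c : E) ^ α c) (_ : h = w * ∏ c, (x c : E) ^ β c)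
      (_ : ∀ c, 0 < β c → 0 < α c) (_ : ∃ c, 0 < β c)
      (_ : (Finset.univ.filter (fun c => 0 < α c ∧ β c = 0)).card ≤ m),
    ∃ (t' : Set E), t ⊆ t' ∧ t'.Finite ∧ (∀ y ∈ t', ∃ n : ℕ, f ^ n * y ∈ R₀) ∧
      ∃ (hT'O : (Algebra.adjoin S t').toSubring ≤ O.toSubring),
        IsRegularLocalRing (locAtCentre (Algebra.adjoin S t').toSubring O) ∧
        locAtCentre (Algebra.adjoin S t).toSubring O ≤
          locAtCentre (Algebra.adjoin S t').toSubring O ∧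
        ∃ (x' : Fin d → locAtCentre (Algebra.adjoin S t').toSubring O) (u' w' : E)
          (α' β' : Fin d → ℕ),
          (haveI := isLocalRing_locAtCentre hT'O
           Ideal.span (Set.range x') = maximalIdeal _) ∧
          u' ∈ locAtCentre (Algebra.adjoin S t').toSubring O ∧ O.valuation u' = 1 ∧
          w' ∈ locAtCentre (Algebra.adjoin S t').toSubring O ∧ O.valuation w' = 1 ∧
          f = u' * ∏ c, (x' c : E) ^ α' c ∧ h = w' * ∏ c, (x' c : E) ^ β' c ∧
          (∀ c, 0 < α' c ↔ 0 < β' c) := by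
  classical
  induction m with
  | zero =>
    intro t ht hTR hTO hreg x hx h u w huR hvu hwR hvw α β hf hh hFE hF hm
    refine ⟨t, le_rfl, ht, hTR, hTO, hreg, le_rfl, x, u, w, α, β, hx, huR, hvu, hwR, hvw, hf, hh,
      fun c => ⟨fun hαc => ?_, hFE c⟩⟩
    by_contra hβc
    have : c ∈ Finset.univ.filter (fun c => 0 < α c ∧ β c = 0) :=
      Finset.mem_filter.mpr ⟨Finset.mem_univ _, hαc, Nat.eq_zero_of_not_pos hβc⟩
    rw [Nat.le_zero, Finset.card_eq_zero] at hm
    rw [hm] at this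
    exact absurd this (Finset.notMem_empty _)
  | succ k ih =>
    intro t ht hTR hTO hreg x hx h u w huR hvu hwR hvw α β hf hh hFE hF hm
    by_cases h0 : (Finset.univ.filter (fun c => 0 < α c ∧ β c = 0)).card = 0
    · exact ih t ht hTR hTO hreg x hx h u w huR hvu hwR hvw α β hf hh hFE hF
        (h0.trans_le (Nat.zero_le _))
    · -- pick `i₁ ∈ E ∖ F`, `i₂ ∈ F`, and the archimedean bound
      obtain ⟨i₁, hi₁⟩ := Finset.card_pos.mp (Nat.pos_of_ne_zero h0)
      obtain ⟨-, hα₁, hβ₁⟩ := Finset.mem_filter.mp hi₁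
      obtain ⟨i₂, hβ₂⟩ := hF
      haveI := isLocalRing_locAtCentre hTO
      have hx2m : O.valuation (x i₂ : E) < 1 :=
        (mem_maximalIdeal_locAtCentre_iff hTO _).mp (hx ▸ Ideal.subset_span ⟨i₂, rfl⟩)
      have hx1ne : (x i₁ : E) ≠ 0 :=
        coe_rsop_ne_zero_of_frame hSuc hinj O hSO hdom hres hSdim t ht hTO hreg x hx i₁
      obtain ⟨n, hn⟩ := harch (x i₂ : E) (x i₁ : E) hx1ne hx2m
      obtain ⟨t', htt', ht', hTR', hT'O, hreg', x', u', w', α', β', hspan', hu'R, hvu', hw'R, hvw',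
        hf', hh', hFE', hF', hcard⟩ :=
        exists_frameStepsTracked_measure_lt hSuc hinj O hSO hdom hres hSdim R₀ hSR₀ f hfR₀ n t ht
          hTR hTO hreg x hx h u w huR hvu hwR hvw α β hf hh hFE i₁ i₂ hα₁ hβ₁ hβ₂ hn
      have hsub : locAtCentre (Algebra.adjoin S t).toSubring O ≤
          locAtCentre (Algebra.adjoin S t').toSubring O :=
        locAtCentre_mono O (fun y hy => Algebra.adjoin_mono htt' hy)
      obtain ⟨t'', ht't'', ht'', hTR'', hT''O, hreg'', hsub'', x'', u'', w'', α'', β'', hspan'',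
        hu''R, hvu'', hw''R, hvw'', hf'', hh'', hiff⟩ :=
        ih t' ht' hTR' hT'O hreg' x' hspan' h u' w' hu'R hvu' hw'R hvw' α' β' hf' hh' hFE' hF'
          (Nat.le_of_lt_succ (lt_of_lt_of_le hcard hm))
      exact ⟨t'', htt'.trans ht't'', ht'', hTR'', hT''O, hreg'', hsub.trans hsub'', x'', u'', w'',
        α'', β'', hspan'', hu''R, hvu'', hw''R, hvw'', hf'', hh'', hiff⟩

set_option maxHeartbeats 400000 in
include hSuc hinj hSO hdom hres hSdim hSR₀ in
/-- **The tracked `E = F` reduction for a rank-one valuation.**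
[cite: CossartPiltant2008, proof of Prop. 8.1 (HAL p. 23)] -/
theorem exists_frameStepsTracked_supp_eq_of_rankOne (f : E) (hfR₀ : f ∈ R₀)
    (hr : Nonempty O.valuation.RankOne)
    (t : Set E) (ht : t.Finite) (hTR : ∀ y ∈ t, ∃ n : ℕ, f ^ n * y ∈ R₀)
    (hTO : (Algebra.adjoin S t).toSubring ≤ O.toSubring)
    (hreg : IsRegularLocalRing (locAtCentre (Algebra.adjoin S t).toSubring O))
    (x : Fin d → locAtCentre (Algebra.adjoin S t).toSubring O)
    (hx : haveI := isLocalRing_locAtCentre hTO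
      Ideal.span (Set.range x) = maximalIdeal _)
    (h u w : E) (huR : u ∈ locAtCentre (Algebra.adjoin S t).toSubring O)
    (hvu : O.valuation u = 1) (hwR : w ∈ locAtCentre (Algebra.adjoin S t).toSubring O)
    (hvw : O.valuation w = 1) (α β : Fin d → ℕ)
    (hf : f = u * ∏ c, (x c : E) ^ α c) (hh : h = w * ∏ c, (x c : E) ^ β c)
    (hFE : ∀ c, 0 < β c → 0 < α c) (hF : ∃ c, 0 < β c) :
    ∃ (t' : Set E), t ⊆ t' ∧ t'.Finite ∧ (∀ y ∈ t', ∃ n : ℕ, f ^ n * y ∈ R₀) ∧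
      ∃ (hT'O : (Algebra.adjoin S t').toSubring ≤ O.toSubring),
        IsRegularLocalRing (locAtCentre (Algebra.adjoin S t').toSubring O) ∧
        locAtCentre (Algebra.adjoin S t).toSubring O ≤
          locAtCentre (Algebra.adjoin S t').toSubring O ∧
        ∃ (x' : Fin d → locAtCentre (Algebra.adjoin S t').toSubring O) (u' w' : E)
          (α' β' : Fin d → ℕ),
          (haveI := isLocalRing_locAtCentre hT'O
           Ideal.span (Set.range x') = maximalIdeal _) ∧
          u' ∈ locAtCentre (Algebra.adjoin S t').toSubring O ∧ O.valuation u' = 1 ∧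
          w' ∈ locAtCentre (Algebra.adjoin S t').toSubring O ∧ O.valuation w' = 1 ∧
          f = u' * ∏ c, (x' c : E) ^ α' c ∧ h = w' * ∏ c, (x' c : E) ^ β' c ∧
          (∀ c, 0 < α' c ↔ 0 < β' c) :=
  exists_frameStepsTracked_supp_eq hSuc hinj O hSO hdom hres hSdim R₀ hSR₀ f hfR₀
    (fun y z hz hy => exists_pow_valuation_le_of_rankOne O hr y z hz hy) _ t ht hTR hTO hreg x hx
    h u w huR hvu hwR hvw α β hf hh hFE hF le_rfl

/-! ### The same, confined to a subfield (for `t′ ⊆ K′` in the head of [CoP1] Prop. 9.3) -/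

set_option maxHeartbeats 1600000 in
include hSuc hinj hSO hdom hres hSdim hSR₀ in
/-- `exists_frameStepTracked_measure_lt`, with the new generators confined to a subfield
`F ⊇ S ∪ t`. [cite: CossartPiltant2008, proof of Prop. 8.1 (HAL p. 23)] -/
theorem exists_frameStepTracked_measure_lt_subset (f : E) (hfR₀ : f ∈ R₀)
    (F : Subfield E) (hSF : ∀ s : S, algebraMap S E s ∈ F)
    (t : Set E) (ht : t.Finite) (htF : t ⊆ F) (hTR : ∀ y ∈ t, ∃ n : ℕ, f ^ n * y ∈ R₀)
    (hTO : (Algebra.adjoin S t).toSubring ≤ O.toSubring)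
    (hreg : IsRegularLocalRing (locAtCentre (Algebra.adjoin S t).toSubring O))
    (x : Fin d → locAtCentre (Algebra.adjoin S t).toSubring O)
    (hx : haveI := isLocalRing_locAtCentre hTO
      Ideal.span (Set.range x) = maximalIdeal _)
    (h u w : E) (huR : u ∈ locAtCentre (Algebra.adjoin S t).toSubring O)
    (hvu : O.valuation u = 1) (hwR : w ∈ locAtCentre (Algebra.adjoin S t).toSubring O)
    (hvw : O.valuation w = 1) (α β : Fin d → ℕ)
    (hf : f = u * ∏ c, (x c : E) ^ α c) (hh : h = w * ∏ c, (x c : E) ^ β c)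
    (hFE : ∀ c, 0 < β c → 0 < α c) (i₁ i₂ : Fin d) (hα₁ : 0 < α i₁) (hβ₁ : β i₁ = 0)
    (hβ₂ : 0 < β i₂) (hle : O.valuation (x i₂ : E) ≤ O.valuation (x i₁ : E)) :
    ∃ (t' : Set E), t ⊆ t' ∧ t'.Finite ∧ t' ⊆ F ∧ (∀ y ∈ t', ∃ n : ℕ, f ^ n * y ∈ R₀) ∧
      ∃ (hT'O : (Algebra.adjoin S t').toSubring ≤ O.toSubring),
        IsRegularLocalRing (locAtCentre (Algebra.adjoin S t').toSubring O) ∧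
        ∃ (x' : Fin d → locAtCentre (Algebra.adjoin S t').toSubring O) (u' w' : E)
          (α' β' : Fin d → ℕ),
          (haveI := isLocalRing_locAtCentre hT'O
           Ideal.span (Set.range x') = maximalIdeal _) ∧
          u' ∈ locAtCentre (Algebra.adjoin S t').toSubring O ∧ O.valuation u' = 1 ∧
          w' ∈ locAtCentre (Algebra.adjoin S t').toSubring O ∧ O.valuation w' = 1 ∧
          f = u' * ∏ c, (x' c : E) ^ α' c ∧ h = w' * ∏ c, (x' c : E) ^ β' c ∧
          (∀ c, 0 < β' c → 0 < α' c) ∧ (∃ c, 0 < β' c) ∧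
          (Finset.univ.filter (fun c => 0 < α' c ∧ β' c = 0)).card <
            (Finset.univ.filter (fun c => 0 < α c ∧ β c = 0)).card := by
  classical
  have h12 : i₁ ≠ i₂ := by rintro rfl; exact (Nat.lt_irrefl 0) (hβ₁ ▸ hβ₂)
  set z : E := (x i₂ : E) / (x i₁ : E) with hzdef
  haveI := isLocalRing_locAtCentre hTO
  -- the old measure set contains `i₁`
  have hi₁mem : i₁ ∈ Finset.univ.filter (fun c => 0 < α c ∧ β c = 0) :=
    Finset.mem_filter.mpr ⟨Finset.mem_univ _, hα₁, hβ₁⟩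
  have hx10 : (x i₁ : E) ≠ 0 :=
    coe_rsop_ne_zero_of_frame hSuc hinj O hSO hdom hres hSdim t ht hTO hreg x hx i₁
  have hzf : z * f ∈ locAtCentre (Algebra.adjoin S t).toSubring O :=
    div_mul_monomial_mem_locAtCentre O t x f u huR α hf i₁ i₂ hα₁ hx10
  have hzle : O.valuation z ≤ 1 := by
    rw [hzdef, map_div₀]; exact div_le_one_of_le₀ hle zero_le
  rcases hzle.lt_or_eq with hlt | h1
  · /- `v(z) > 0`: `z` is a new regular parameter, `i₁` enters `F` -/
    obtain ⟨t₁, htt₁, ht₁, ht₁F, hTR₁, hT₁O, hreg₁, x', hx'c, hx'b, hspan, hmono⟩ :=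
      exists_frameStepTracked_of_valuation_lt_one_subset hSuc hinj O hSO hdom hres hSdim R₀ hSR₀ f
        hfR₀ F hSF t ht htF hTR hTO hreg x hx i₁ i₂ h12 hlt hzf
    have hsub : locAtCentre (Algebra.adjoin S t).toSubring O ≤
        locAtCentre (Algebra.adjoin S t₁).toSubring O :=
      locAtCentre_mono O (fun y hy => Algebra.adjoin_mono htt₁ hy)
    refine ⟨t₁, htt₁, ht₁, ht₁F, hTR₁, hT₁O, hreg₁, x', u, w,
      Function.update α i₁ (α i₁ + α i₂), Function.update β i₁ (β i₁ + β i₂), hspan,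
      hsub huR, hvu, hsub hwR, hvw, ?_, ?_, fun c hc => ?_, ⟨i₁, ?_⟩, ?_⟩
    · rw [hf, hmono α]
    · rw [hh, hmono β]
    · by_cases hc1 : c = i₁
      · subst hc1
        rw [Function.update_self]
        exact Nat.add_pos_left hα₁ _
      · rw [Function.update_of_ne hc1] at hc ⊢
        exact hFE c hc
    · rw [Function.update_self, hβ₁, zero_add]; exact hβ₂
    · refine Finset.card_lt_card ⟨fun c hc => ?_, fun hsub' => ?_⟩
      · obtain ⟨-, hαc, hβc⟩ := Finset.mem_filter.mp hc
        have hc1 : c ≠ i₁ := by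
          rintro rfl
          rw [Function.update_self, hβ₁, zero_add] at hβc
          exact absurd hβc (Nat.pos_iff_ne_zero.mp hβ₂)
        rw [Function.update_of_ne hc1] at hαc hβc
        exact Finset.mem_filter.mpr ⟨Finset.mem_univ _, hαc, hβc⟩
      · have hb : Function.update β i₁ (β i₁ + β i₂) i₁ = 0 :=
          (Finset.mem_filter.mp (hsub' hi₁mem)).2.2
        rw [Function.update_self, hβ₁, zero_add] at hb
        exact absurd hb (Nat.pos_iff_ne_zero.mp hβ₂)
  · /- `v(z) = 0`: `z` is a unit, `i₂` leaves `E` and `F`, `i₁` enters `F` -/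
    obtain ⟨t₁, htt₁, ht₁, ht₁F, hTR₁, hT₁O, hreg₁, hzR, x', hx'c, hspan, hmono⟩ :=
      exists_frameStepTracked_of_valuation_eq_one_subset hSuc hinj O hSO hdom hres hSdim R₀ hSR₀ f
        hfR₀ F hSF t ht htF hTR hTO hreg x hx i₁ i₂ h12 h1 hzf
    have hsub : locAtCentre (Algebra.adjoin S t).toSubring O ≤
        locAtCentre (Algebra.adjoin S t₁).toSubring O :=
      locAtCentre_mono O (fun y hy => Algebra.adjoin_mono htt₁ hy)
    refine ⟨t₁, htt₁, ht₁, ht₁F, hTR₁, hT₁O, hreg₁, x',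
      u * z ^ α i₂, w * z ^ β i₂,
      Function.update (Function.update α i₁ (α i₁ + α i₂)) i₂ 0,
      Function.update (Function.update β i₁ (β i₁ + β i₂)) i₂ 0, hspan,
      Subring.mul_mem _ (hsub huR) (Subring.pow_mem _ hzR _), ?_,
      Subring.mul_mem _ (hsub hwR) (Subring.pow_mem _ hzR _), ?_, ?_, ?_,
      fun c hc => ?_, ⟨i₁, ?_⟩, ?_⟩
    · rw [map_mul, map_pow, hvu, h1, one_pow, one_mul]
    · rw [map_mul, map_pow, hvw, h1, one_pow, one_mul]
    · rw [hf, hmono α, mul_assoc]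
    · rw [hh, hmono β, mul_assoc]
    · by_cases hc2 : c = i₂
      · subst hc2; rw [Function.update_self] at hc; exact absurd hc (Nat.lt_irrefl 0)
      · rw [Function.update_of_ne hc2] at hc ⊢
        by_cases hc1 : c = i₁
        · subst hc1
          rw [Function.update_self]
          exact Nat.add_pos_left hα₁ _
        · rw [Function.update_of_ne hc1] at hc ⊢
          exact hFE c hc
    · rw [Function.update_of_ne h12, Function.update_self, hβ₁, zero_add]; exact hβ₂
    · refine Finset.card_lt_card ⟨fun c hc => ?_, fun hsub' => ?_⟩
      · obtain ⟨-, hαc, hβc⟩ := Finset.mem_filter.mp hc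
        have hc2 : c ≠ i₂ := by
          rintro rfl
          rw [Function.update_self] at hαc
          exact (Nat.lt_irrefl 0) hαc
        rw [Function.update_of_ne hc2] at hαc hβc
        have hc1 : c ≠ i₁ := by
          rintro rfl
          rw [Function.update_self, hβ₁, zero_add] at hβc
          exact absurd hβc (Nat.pos_iff_ne_zero.mp hβ₂)
        rw [Function.update_of_ne hc1] at hαc hβc
        exact Finset.mem_filter.mpr ⟨Finset.mem_univ _, hαc, hβc⟩
      · have hb : Function.update (Function.update β i₁ (β i₁ + β i₂)) i₂ 0 i₁ = 0 :=
          (Finset.mem_filter.mp (hsub' hi₁mem)).2.2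
        rw [Function.update_of_ne h12, Function.update_self, hβ₁, zero_add] at hb
        exact absurd hb (Nat.pos_iff_ne_zero.mp hβ₂)

set_option maxHeartbeats 1600000 in
include hSuc hinj hSO hdom hres hSdim hSR₀ in
/-- `exists_frameStepsTracked_measure_lt`, with the new generators confined to a subfield
`F ⊇ S ∪ t`. [cite: CossartPiltant2008, proof of Prop. 8.1 (HAL p. 23)] -/
theorem exists_frameStepsTracked_measure_lt_subset (f : E) (hfR₀ : f ∈ R₀)
    (F : Subfield E) (hSF : ∀ s : S, algebraMap S E s ∈ F) (n : ℕ) :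
    ∀ (t : Set E) (_ : t.Finite) (_ : t ⊆ F) (_ : ∀ y ∈ t, ∃ n : ℕ, f ^ n * y ∈ R₀)
      (hTO : (Algebra.adjoin S t).toSubring ≤ O.toSubring)
      (_ : IsRegularLocalRing (locAtCentre (Algebra.adjoin S t).toSubring O))
      (x : Fin d → locAtCentre (Algebra.adjoin S t).toSubring O)
      (_ : haveI := isLocalRing_locAtCentre hTO
        Ideal.span (Set.range x) = maximalIdeal _)
      (h u w : E) (_ : u ∈ locAtCentre (Algebra.adjoin S t).toSubring O)
      (_ : O.valuation u = 1) (_ : w ∈ locAtCentre (Algebra.adjoin S t).toSubring O)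
      (_ : O.valuation w = 1) (α β : Fin d → ℕ)
      (_ : f = u * ∏ c, (x c : E) ^ α c) (_ : h = w * ∏ c, (x c : E) ^ β c)
      (_ : ∀ c, 0 < β c → 0 < α c) (i₁ i₂ : Fin d) (_ : 0 < α i₁) (_ : β i₁ = 0)
      (_ : 0 < β i₂) (_ : O.valuation (x i₂ : E) ^ n ≤ O.valuation (x i₁ : E)),
    ∃ (t' : Set E), t ⊆ t' ∧ t'.Finite ∧ t' ⊆ F ∧ (∀ y ∈ t', ∃ n : ℕ, f ^ n * y ∈ R₀) ∧
      ∃ (hT'O : (Algebra.adjoin S t').toSubring ≤ O.toSubring),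
        IsRegularLocalRing (locAtCentre (Algebra.adjoin S t').toSubring O) ∧
        ∃ (x' : Fin d → locAtCentre (Algebra.adjoin S t').toSubring O) (u' w' : E)
          (α' β' : Fin d → ℕ),
          (haveI := isLocalRing_locAtCentre hT'O
           Ideal.span (Set.range x') = maximalIdeal _) ∧
          u' ∈ locAtCentre (Algebra.adjoin S t').toSubring O ∧ O.valuation u' = 1 ∧
          w' ∈ locAtCentre (Algebra.adjoin S t').toSubring O ∧ O.valuation w' = 1 ∧
          f = u' * ∏ c, (x' c : E) ^ α' c ∧ h = w' * ∏ c, (x' c : E) ^ β' c ∧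
          (∀ c, 0 < β' c → 0 < α' c) ∧ (∃ c, 0 < β' c) ∧
          (Finset.univ.filter (fun c => 0 < α' c ∧ β' c = 0)).card <
            (Finset.univ.filter (fun c => 0 < α c ∧ β c = 0)).card := by
  classical
  induction n with
  | zero =>
    intro t ht htF hTR hTO hreg x hx h u w huR hvu hwR hvw α β hf hh hFE i₁ i₂ hα₁ hβ₁ hβ₂ hn
    exfalso
    haveI := isLocalRing_locAtCentre hTO
    have hlt : O.valuation (x i₁ : E) < 1 :=
      (mem_maximalIdeal_locAtCentre_iff hTO _).mp (hx ▸ Ideal.subset_span ⟨i₁, rfl⟩)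
    rw [pow_zero] at hn
    exact (lt_irrefl _) (lt_of_le_of_lt hn hlt)
  | succ k ih =>
    intro t ht htF hTR hTO hreg x hx h u w huR hvu hwR hvw α β hf hh hFE i₁ i₂ hα₁ hβ₁ hβ₂ hn
    by_cases hle : O.valuation (x i₂ : E) ≤ O.valuation (x i₁ : E)
    · exact exists_frameStepTracked_measure_lt_subset hSuc hinj O hSO hdom hres hSdim R₀ hSR₀ f
        hfR₀ F hSF t ht htF hTR hTO hreg x hx h u w huR hvu hwR hvw α β hf hh hFE i₁ i₂ hα₁ hβ₁
        hβ₂ hle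
    · -- `W y_{i₂} < W y_{i₁}`: transform at `(x_{i₂}, x_{i₁})`, chart `z = x_{i₁}/x_{i₂}`
      have h12 : i₁ ≠ i₂ := by rintro rfl; exact (Nat.lt_irrefl 0) (hβ₁ ▸ hβ₂)
      have hlt' : O.valuation (x i₁ : E) < O.valuation (x i₂ : E) := lt_of_not_ge hle
      haveI := isLocalRing_locAtCentre hTO
      have hx2ne : O.valuation (x i₂ : E) ≠ 0 := by
        intro h0
        rw [h0] at hlt'
        exact not_lt_of_ge zero_le hlt'
      have hzlt : O.valuation ((x i₁ : E) / (x i₂ : E)) < 1 := by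
        rw [map_div₀, div_lt_one₀ (zero_lt_iff.mpr hx2ne)]
        exact hlt'
      have hzf : (x i₁ : E) / (x i₂ : E) * f ∈ locAtCentre (Algebra.adjoin S t).toSubring O :=
        div_mul_monomial_mem_locAtCentre O t x f u huR α hf i₂ i₁ (hFE _ hβ₂)
          (fun h0 => hx2ne (by rw [h0, map_zero]))
      set z : E := (x i₁ : E) / (x i₂ : E) with hzdef
      obtain ⟨t₁, htt₁, ht₁, ht₁F, hTR₁, hT₁O, hreg₁, x', hx'c, hx'b, hspan, hmono⟩ :=
        exists_frameStepTracked_of_valuation_lt_one_subset hSuc hinj O hSO hdom hres hSdim R₀ hSR₀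
          f hfR₀ F hSF t ht htF hTR hTO hreg x hx i₂ i₁ h12.symm hzlt hzf
      have hsub : locAtCentre (Algebra.adjoin S t).toSubring O ≤
          locAtCentre (Algebra.adjoin S t₁).toSubring O :=
        locAtCentre_mono O (fun y hy => Algebra.adjoin_mono htt₁ hy)
      -- the new state has the same `E`, `F`, and a smaller archimedean bound
      have hn' : O.valuation (x' i₂ : E) ^ k ≤ O.valuation (x' i₁ : E) := by
        rw [hx'c i₂ h12.symm, hx'b, map_div₀, le_div_iff₀ (zero_lt_iff.mpr hx2ne), ← pow_succ]
        exact hn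
      obtain ⟨t', htt', ht', ht'F, hTR', hT'O, hreg', x'', u', w', α', β', hspan', hu'R, hvu',
        hw'R, hvw', hf', hh', hFE', hF', hcard⟩ :=
        ih t₁ ht₁ ht₁F hTR₁ hT₁O hreg₁ x' hspan h u w (hsub huR) hvu (hsub hwR) hvw
          (Function.update α i₂ (α i₂ + α i₁)) (Function.update β i₂ (β i₂ + β i₁))
          (by rw [hf, hmono α]) (by rw [hh, hmono β])
          (fun c hc => by
            by_cases hc2 : c = i₂
            · subst hc2; rw [Function.update_self]; exact Nat.add_pos_left (hFE _ hβ₂) _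
            · rw [Function.update_of_ne hc2] at hc ⊢; exact hFE c hc)
          i₁ i₂ (by rw [Function.update_of_ne h12]; exact hα₁)
          (by rw [Function.update_of_ne h12]; exact hβ₁)
          (by rw [Function.update_self]; exact Nat.add_pos_left hβ₂ _) hn'
      refine ⟨t', htt₁.trans htt', ht', ht'F, hTR', hT'O, hreg', x'', u', w', α', β',
        hspan', hu'R, hvu', hw'R, hvw', hf', hh', hFE', hF', lt_of_lt_of_le hcard (le_of_eq ?_)⟩
      -- the measure set is unchanged by this step
      congr 1
      ext c
      simp only [Finset.mem_filter, Finset.mem_univ, true_and]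
      by_cases hc2 : c = i₂
      · subst hc2
        rw [Function.update_self, Function.update_self]
        constructor
        · rintro ⟨-, h0⟩; exact absurd h0 (Nat.ne_of_gt (Nat.add_pos_left hβ₂ _))
        · rintro ⟨-, h0⟩; exact absurd h0 (Nat.ne_of_gt hβ₂)
      · rw [Function.update_of_ne hc2, Function.update_of_ne hc2]

set_option maxHeartbeats 1600000 in
include hSuc hinj hSO hdom hres hSdim hSR₀ in
/-- `exists_frameStepsTracked_supp_eq` (the tracked `E = F` reduction), with the new
generators confined to a subfield `F ⊇ S ∪ t`.
[cite: CossartPiltant2008, proof of Prop. 8.1 (HAL p. 23)] -/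
theorem exists_frameStepsTracked_supp_eq_subset (f : E) (hfR₀ : f ∈ R₀)
    (F : Subfield E) (hSF : ∀ s : S, algebraMap S E s ∈ F)
    (harch : ∀ y z : E, z ≠ 0 → O.valuation y < 1 → ∃ n : ℕ, O.valuation y ^ n ≤ O.valuation z)
    (m : ℕ) :
    ∀ (t : Set E) (_ : t.Finite) (_ : t ⊆ F) (_ : ∀ y ∈ t, ∃ n : ℕ, f ^ n * y ∈ R₀)
      (hTO : (Algebra.adjoin S t).toSubring ≤ O.toSubring)
      (_ : IsRegularLocalRing (locAtCentre (Algebra.adjoin S t).toSubring O))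
      (x : Fin d → locAtCentre (Algebra.adjoin S t).toSubring O)
      (_ : haveI := isLocalRing_locAtCentre hTO
        Ideal.span (Set.range x) = maximalIdeal _)
      (h u w : E) (_ : u ∈ locAtCentre (Algebra.adjoin S t).toSubring O)
      (_ : O.valuation u = 1) (_ : w ∈ locAtCentre (Algebra.adjoin S t).toSubring O)
      (_ : O.valuation w = 1) (α β : Fin d → ℕ)
      (_ : f = u * ∏ c, (x c : E) ^ α c) (_ : h = w * ∏ c, (x c : E) ^ β c)
      (_ : ∀ c, 0 < β c → 0 < α c) (_ : ∃ c, 0 < β c)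
      (_ : (Finset.univ.filter (fun c => 0 < α c ∧ β c = 0)).card ≤ m),
    ∃ (t' : Set E), t ⊆ t' ∧ t'.Finite ∧ t' ⊆ F ∧ (∀ y ∈ t', ∃ n : ℕ, f ^ n * y ∈ R₀) ∧
      ∃ (hT'O : (Algebra.adjoin S t').toSubring ≤ O.toSubring),
        IsRegularLocalRing (locAtCentre (Algebra.adjoin S t').toSubring O) ∧
        locAtCentre (Algebra.adjoin S t).toSubring O ≤
          locAtCentre (Algebra.adjoin S t').toSubring O ∧
        ∃ (x' : Fin d → locAtCentre (Algebra.adjoin S t').toSubring O) (u' w' : E)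
          (α' β' : Fin d → ℕ),
          (haveI := isLocalRing_locAtCentre hT'O
           Ideal.span (Set.range x') = maximalIdeal _) ∧
          u' ∈ locAtCentre (Algebra.adjoin S t').toSubring O ∧ O.valuation u' = 1 ∧
          w' ∈ locAtCentre (Algebra.adjoin S t').toSubring O ∧ O.valuation w' = 1 ∧
          f = u' * ∏ c, (x' c : E) ^ α' c ∧ h = w' * ∏ c, (x' c : E) ^ β' c ∧
          (∀ c, 0 < α' c ↔ 0 < β' c) := by
  classical
  induction m with
  | zero =>
    intro t ht htF hTR hTO hreg x hx h u w huR hvu hwR hvw α β hf hh hFE hF hm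
    refine ⟨t, le_rfl, ht, htF, hTR, hTO, hreg, le_rfl, x, u, w, α, β, hx, huR, hvu, hwR, hvw,
      hf, hh, fun c => ⟨fun hαc => ?_, hFE c⟩⟩
    by_contra hβc
    have : c ∈ Finset.univ.filter (fun c => 0 < α c ∧ β c = 0) :=
      Finset.mem_filter.mpr ⟨Finset.mem_univ _, hαc, Nat.eq_zero_of_not_pos hβc⟩
    rw [Nat.le_zero, Finset.card_eq_zero] at hm
    rw [hm] at this
    exact absurd this (Finset.notMem_empty _)
  | succ k ih =>
    intro t ht htF hTR hTO hreg x hx h u w huR hvu hwR hvw α β hf hh hFE hF hm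
    by_cases h0 : (Finset.univ.filter (fun c => 0 < α c ∧ β c = 0)).card = 0
    · exact ih t ht htF hTR hTO hreg x hx h u w huR hvu hwR hvw α β hf hh hFE hF
        (h0.trans_le (Nat.zero_le _))
    · -- pick `i₁ ∈ E ∖ F`, `i₂ ∈ F`, and the archimedean bound
      obtain ⟨i₁, hi₁⟩ := Finset.card_pos.mp (Nat.pos_of_ne_zero h0)
      obtain ⟨-, hα₁, hβ₁⟩ := Finset.mem_filter.mp hi₁
      obtain ⟨i₂, hβ₂⟩ := hF
      haveI := isLocalRing_locAtCentre hTO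
      have hx2m : O.valuation (x i₂ : E) < 1 :=
        (mem_maximalIdeal_locAtCentre_iff hTO _).mp (hx ▸ Ideal.subset_span ⟨i₂, rfl⟩)
      have hx1ne : (x i₁ : E) ≠ 0 :=
        coe_rsop_ne_zero_of_frame hSuc hinj O hSO hdom hres hSdim t ht hTO hreg x hx i₁
      obtain ⟨n, hn⟩ := harch (x i₂ : E) (x i₁ : E) hx1ne hx2m
      obtain ⟨t', htt', ht', ht'F, hTR', hT'O, hreg', x', u', w', α', β', hspan', hu'R, hvu',
        hw'R, hvw', hf', hh', hFE', hF', hcard⟩ :=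
        exists_frameStepsTracked_measure_lt_subset hSuc hinj O hSO hdom hres hSdim R₀ hSR₀ f hfR₀ F
          hSF n t ht htF hTR hTO hreg x hx h u w huR hvu hwR hvw α β hf hh hFE i₁ i₂ hα₁ hβ₁ hβ₂ hn
      have hsub : locAtCentre (Algebra.adjoin S t).toSubring O ≤
          locAtCentre (Algebra.adjoin S t').toSubring O :=
        locAtCentre_mono O (fun y hy => Algebra.adjoin_mono htt' hy)
      obtain ⟨t'', ht't'', ht'', ht''F, hTR'', hT''O, hreg'', hsub'', x'', u'', w'', α'', β'',
        hspan'', hu''R, hvu'', hw''R, hvw'', hf'', hh'', hiff⟩ :=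
        ih t' ht' ht'F hTR' hT'O hreg' x' hspan' h u' w' hu'R hvu' hw'R hvw' α' β' hf' hh' hFE' hF'
          (Nat.le_of_lt_succ (lt_of_lt_of_le hcard hm))
      exact ⟨t'', htt'.trans ht't'', ht'', ht''F, hTR'', hT''O, hreg'', hsub.trans hsub'', x'', u'',
        w'', α'', β'', hspan'', hu''R, hvu'', hw''R, hvw'', hf'', hh'', hiff⟩

set_option maxHeartbeats 400000 in
include hSuc hinj hSO hdom hres hSdim hSR₀ in
/-- `exists_frameStepsTracked_supp_eq_of_rankOne`, with the new generators confined to a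
subfield `F ⊇ S ∪ t`. [cite: CossartPiltant2008, proof of Prop. 8.1 (HAL p. 23)] -/
theorem exists_frameStepsTracked_supp_eq_of_rankOne_subset (f : E) (hfR₀ : f ∈ R₀)
    (F : Subfield E) (hSF : ∀ s : S, algebraMap S E s ∈ F)
    (hr : Nonempty O.valuation.RankOne)
    (t : Set E) (ht : t.Finite) (htF : t ⊆ F) (hTR : ∀ y ∈ t, ∃ n : ℕ, f ^ n * y ∈ R₀)
    (hTO : (Algebra.adjoin S t).toSubring ≤ O.toSubring)
    (hreg : IsRegularLocalRing (locAtCentre (Algebra.adjoin S t).toSubring O))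
    (x : Fin d → locAtCentre (Algebra.adjoin S t).toSubring O)
    (hx : haveI := isLocalRing_locAtCentre hTO
      Ideal.span (Set.range x) = maximalIdeal _)
    (h u w : E) (huR : u ∈ locAtCentre (Algebra.adjoin S t).toSubring O)
    (hvu : O.valuation u = 1) (hwR : w ∈ locAtCentre (Algebra.adjoin S t).toSubring O)
    (hvw : O.valuation w = 1) (α β : Fin d → ℕ)
    (hf : f = u * ∏ c, (x c : E) ^ α c) (hh : h = w * ∏ c, (x c : E) ^ β c)
    (hFE : ∀ c, 0 < β c → 0 < α c) (hF : ∃ c, 0 < β c) :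
    ∃ (t' : Set E), t ⊆ t' ∧ t'.Finite ∧ t' ⊆ F ∧ (∀ y ∈ t', ∃ n : ℕ, f ^ n * y ∈ R₀) ∧
      ∃ (hT'O : (Algebra.adjoin S t').toSubring ≤ O.toSubring),
        IsRegularLocalRing (locAtCentre (Algebra.adjoin S t').toSubring O) ∧
        locAtCentre (Algebra.adjoin S t).toSubring O ≤
          locAtCentre (Algebra.adjoin S t').toSubring O ∧
        ∃ (x' : Fin d → locAtCentre (Algebra.adjoin S t').toSubring O) (u' w' : E)
          (α' β' : Fin d → ℕ),
          (haveI := isLocalRing_locAtCentre hT'O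
           Ideal.span (Set.range x') = maximalIdeal _) ∧
          u' ∈ locAtCentre (Algebra.adjoin S t').toSubring O ∧ O.valuation u' = 1 ∧
          w' ∈ locAtCentre (Algebra.adjoin S t').toSubring O ∧ O.valuation w' = 1 ∧
          f = u' * ∏ c, (x' c : E) ^ α' c ∧ h = w' * ∏ c, (x' c : E) ^ β' c ∧
          (∀ c, 0 < α' c ↔ 0 < β' c) :=
  exists_frameStepsTracked_supp_eq_subset hSuc hinj O hSO hdom hres hSdim R₀ hSR₀ f hfR₀ F hSF
    (fun y z hz hy => exists_pow_valuation_le_of_rankOne O hr y z hz hy) _ t ht htF hTR hTO hreg x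
    hx h u w huR hvu hwR hvw α β hf hh hFE hF le_rfl

end EFReductionTracked

end Literature.AlgebraicGeometry.Resolution

end
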